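/-
Copyright: pub-rosobs cell (Resolution Observatory), carver gen 41.  Companion file; statements OURS, in
the cell's polynomial weighted-centre model `W(f)`.  Instrument — NOT a resolution theorem.
-/
import Literature.AlgebraicGeometry.Resolution.WeightedCentreBlockMerge
import Literature.AlgebraicGeometry.Resolution.WeightedCentrePureHandleFamily
import HarnessLib

/-!
# Two pure powers: `max W(X_a^e + X_b^F)` (`2 ≤ e < F`) in every characteristic

[cite: AbramovichTemkinWlodarczyk2024, Thm. 5.3.1 (2)–(3) (p. 1578) (`inv = max (b₁,…,b_k)` over admissible
centres), §5.1 (p. 1575)] [cite: CossartJannsenSaito2020, Def. 8.2 (p. 118), Def. 8.13, Def. 8.15, Thm. 8.16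
(pp. 120–121) (`δ`, solvable vertices, `δ`-preparedness)].

The two-summand case of the census's pure-power family law (engine 1, FE33 C136 (b)–(d): `max W(Σ X_i^{e_i}) =
sort CL_p(e)`), in the polynomial model, every field `k`, any number of spectator variables: for `a ≠ b` and
`2 ≤ e < F`,
* `(e, F) ∈ W(X_a^e + X_b^F)` always (the coordinate centre; `WeightedCentreBlockMerge`);
* nothing in `W` lies above `(e, F)` as soon as the vertex `F/e · ε_b` of `Δ(f; X_a)` is NOT solvable
  (`isMaxInv_powPair_of_isDeltaPrepared`), which holds
  - when `e ∤ F` (the vertex is not a lattice point),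
  - when `e` is invertible in `k`: `X_a^e + X_b^F = (X_a + c X_b^t)^e` is impossible (`powPair_ne_add_pow`: killing
    `X_a` forces `c ≠ 0`, then `∂/∂X_a`, cancelling `e`, and killing `X_a` again gives `0 = (cX_b^t)^{e-1}`),
  - in characteristic `p` whenever `e` is NOT a power of `p`: write `e = p^m e'` with `p ∤ e'`, `e' ≥ 2`; by the
    freshman's dream and the injectivity of Frobenius on `k[X]` a solution would give
    `X_a^{e'} + X_b^{e't} = (X_a + cX_b^t)^{e'}`, the invertible case (`isDeltaPrepared_powPair_charP`).
  Hence `max W(X_a^e + X_b^F) = (e, F)` in characteristic `0` always (`isMaxInv_powPair_charZero`) and in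
  characteristic `p` unless `e` is a power of `p` dividing `F` (`isMaxInv_powPair_charP`);
* in the remaining case `e = p^n ∣ F` the far power is ABSORBED (`WeightedCentrePureHandleFamily`):
  `W(X_a^{p^n} + X_b^{p^n t}) = W(X_a^{p^n})`, so `max W = (p^n)` (`isMaxInv_powPair_absorb`, also for `t = 1`);
* equal exponents `e = F ≥ 2`: the initial form is `X_a^e + X_b^e` itself and `τ(X_a^e + X_b^e) = 2` unless `e` is
  a power of the characteristic (`hironakaTau_powPair_self(_charP)`: an invariant translation
  `(Y_a + αT)^e + (Y_b + βT)^e = Y_a^e + Y_b^e` has `α = β = 0`, by the same kill/differentiate/kill moves and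
  Frobenius descent), whence `max W(X_a^e + X_b^e) = (e, e)` (`isMaxInv_powPair_self(_charP)`).
So for two pure powers with `2 ≤ e ≤ F` the law `CL_p` is a theorem of the model (`isMaxInv_powPair_law`,
`isMaxInv_powPair_charZero_of_le`): delete `F` iff `e` is a `p`-power dividing `F`.
-/

noncomputable section

open MvPolynomial

namespace Literature.AlgebraicGeometry.Resolution.WeightedBlowup

variable {k : Type*} [Field k] {N : ℕ}

/-! ## §1 The polynomial and its Newton data -/

section Defs

variable (k) in
/-- The two-pure-powers polynomial `X_a^e + X_b^F`. (construction)
[cite: AbramovichTemkinWlodarczyk2024, §5.1 (p. 1575)] -/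
def powPair (a b : Fin N) (e F : ℕ) : MvPolynomial (Fin N) k := X a ^ e + X b ^ F

end Defs

variable {a b : Fin N} {e F : ℕ}

/-- Unfolding (plumbing). [cite: AbramovichTemkinWlodarczyk2024, §5.1 (p. 1575)] -/
theorem powPair_eq : powPair k a b e F = X a ^ e + X b ^ F := rfl

/-- The two exponents are distinct (plumbing). [folklore] -/
private theorem single_ne_single (hab : a ≠ b) (he : e ≠ 0) :
    (Finsupp.single a e : Fin N →₀ ℕ) ≠ Finsupp.single b F := by
  intro h
  have := congrArg (fun d => d a) h
  simp only [Finsupp.single_eq_same, Finsupp.single_apply, if_neg hab.symm] at this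
  exact he this

/-- Coefficients of `X_a^e + X_b^F` (plumbing). [folklore] -/
private theorem coeff_powPair (d : Fin N →₀ ℕ) :
    coeff d (powPair k a b e F) =
      (if Finsupp.single a e = d then 1 else 0) + (if Finsupp.single b F = d then 1 else 0) := by
  rw [powPair, coeff_add, coeff_X_pow, coeff_X_pow]

/-- The support of `X_a^e + X_b^F`. (derived here) [cite: CossartJannsenSaito2020, Def. 8.2 (p. 118)] -/
theorem support_powPair (hab : a ≠ b) (he : e ≠ 0) :
    (powPair k a b e F).support = {Finsupp.single a e, Finsupp.single b F} := by
  classical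
  have hne := single_ne_single (F := F) hab he
  ext d
  rw [mem_support_iff, coeff_powPair, Finset.mem_insert, Finset.mem_singleton]
  constructor
  · intro h
    by_contra hd
    push Not at hd
    rw [if_neg (Ne.symm hd.1), if_neg (Ne.symm hd.2), add_zero] at h
    exact h rfl
  · rintro (rfl | rfl)
    · rw [if_pos rfl, if_neg (Ne.symm hne)]; norm_num
    · rw [if_pos rfl, if_neg hne]; norm_num

/-- `ord (X_a^e + X_b^F) = e` for `e ≤ F`. (derived here) [cite: CossartJannsenSaito2020, Def. 8.2 (p. 118)] -/
theorem monomialOrd_powPair (hab : a ≠ b) (he : 0 < e) (heF : e ≤ F) :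
    monomialOrd (fun _ => 1) (powPair k a b e F) = e := by
  classical
  have hmem : Finsupp.single a e ∈ (powPair k a b e F).support := by
    rw [support_powPair hab he.ne']; exact Finset.mem_insert_self _ _
  apply le_antisymm
  · refine (monomialOrd_le_weight (fun _ => 1) hmem).trans ?_
    rw [← Finsupp.degree_eq_weight_one, Finsupp.degree_single]
  · rw [le_monomialOrd_one_iff]
    intro d hd
    rw [support_powPair hab he.ne', Finset.mem_insert, Finset.mem_singleton] at hd
    rcases hd with rfl | rfl
    · rw [Finsupp.degree_single]
    · rw [Finsupp.degree_single]; exact heF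

/-- The initial form of `X_a^e + X_b^F` is `X_a^e` for `e < F`. (derived here)
[cite: CossartJannsenSaito2020, Def. 8.2 (p. 118)] -/
theorem homogeneousComponent_powPair (heF : e < F) :
    homogeneousComponent e (powPair k a b e F) = X a ^ e := by
  rw [powPair, map_add, homogeneousComponent_of_mem (isHomogeneous_X_pow a e),
    homogeneousComponent_of_mem (isHomogeneous_X_pow b F), if_pos rfl, if_neg heF.ne, add_zero]

/-- The initial form lives on the block `{a}` (plumbing). [folklore] -/
private theorem hFS_powPair (heF : e < F) :
    ∀ d ∈ (homogeneousComponent e (powPair k a b e F)).support, ∀ x ∉ ({a} : Finset (Fin N)), d x = 0 := by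
  intro d hd x hx
  rw [homogeneousComponent_powPair heF, X_pow_eq_monomial] at hd
  have hd' := Finset.mem_singleton.1 (support_monomial_subset hd)
  rw [Finset.mem_singleton] at hx
  rw [hd', Finsupp.single_apply, if_neg (Ne.symm hx)]

/-- Block data of the far monomial (plumbing). [folklore] -/
private theorem blockDeg_single_b (hab : a ≠ b) : blockDeg ({a} : Finset (Fin N)) (Finsupp.single b F) = 0 := by
  rw [blockDeg_singleton, Finsupp.single_apply, if_neg hab.symm]

/-- Block data of the far monomial (plumbing). [folklore] -/
private theorem coDeg_single_b (hab : a ≠ b) : coDeg ({a} : Finset (Fin N)) (Finsupp.single b F) = F := by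
  rw [coDeg_singleton, Finsupp.degree_single, Finsupp.single_apply, if_neg hab.symm, Nat.sub_zero]

/-- Block data of the far monomial (plumbing). [folklore] -/
private theorem coPart_single_b (hab : a ≠ b) :
    coPart ({a} : Finset (Fin N)) (Finsupp.single b F) = Finsupp.single b F := by
  rw [coPart, Finsupp.filter_eq_self_iff]
  intro x hx
  rw [Finset.mem_singleton]
  rintro rfl
  rw [Finsupp.single_apply, if_neg hab.symm] at hx
  exact hx rfl

/-- Block data of the near monomial (plumbing). [folklore] -/
private theorem coPart_single_a : coPart ({a} : Finset (Fin N)) (Finsupp.single a e) = 0 := by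
  rw [coPart, Finsupp.filter_eq_zero_iff]
  intro x hx
  rw [Finset.mem_singleton] at hx
  rw [Finsupp.single_apply, if_neg (Ne.symm hx)]

/-- **Hironaka's `δ(X_a^e + X_b^F; X_a) = F/e`**: the polyhedron `Δ(f; X_a)` is the orthant at the point
`(F/e)·ε_b`. (derived here) [cite: CossartJannsenSaito2020, Def. 8.2 (p. 118) (δ(f; u; y))] -/
theorem hironakaDelta_powPair (hab : a ≠ b) (he : 0 < e) :
    hironakaDelta {a} e (powPair k a b e F) = ((((F : ℚ) / (e : ℚ)) : ℚ) : WithTop ℚ) := by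
  classical
  have hmem : Finsupp.single b F ∈ (powPair k a b e F).support := by
    rw [support_powPair hab he.ne', Finset.mem_insert, Finset.mem_singleton]; exact Or.inr rfl
  apply le_antisymm
  · unfold hironakaDelta
    refine (Finset.inf_le (Finset.mem_filter.2 ⟨hmem, ?_⟩)).trans ?_
    · rw [blockDeg_single_b hab]; exact he
    · rw [blockDeg_single_b hab, coDeg_single_b hab, Nat.sub_zero]
  · rw [le_hironakaDelta_iff]
    intro d hd hb
    rw [support_powPair hab he.ne', Finset.mem_insert, Finset.mem_singleton] at hd
    rcases hd with rfl | rfl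
    · rw [blockDeg_singleton, Finsupp.single_eq_same] at hb; exact (lt_irrefl _ hb).elim
    · rw [blockDeg_single_b hab, coDeg_single_b hab, Nat.sub_zero]

/-- **The only vertex**: a vertex `v` of `Δ(X_a^e + X_b^F; X_a)` (integral point, polynomial model) satisfies
`e • v = F ε_b`. (derived here) [cite: CossartJannsenSaito2020, Def. 8.1 (2), Def. 8.2 (1) (p. 117–118)] -/
theorem smul_eq_single_of_isVertex_powPair (hab : a ≠ b) (he : 0 < e) {v : Fin N →₀ ℕ}
    (hv : IsVertex {a} e (powPair k a b e F) v) : e • v = Finsupp.single b F := by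
  classical
  obtain ⟨⟨d, hd, hlt, hco⟩, -⟩ := hv
  rw [support_powPair hab he.ne', Finset.mem_insert, Finset.mem_singleton] at hd
  rcases hd with rfl | rfl
  · rw [blockDeg_singleton, Finsupp.single_eq_same] at hlt; exact (lt_irrefl _ hlt).elim
  · rw [blockDeg_single_b hab, Nat.sub_zero, coPart_single_b hab] at hco
    exact hco.symm

/-- A vertex, written out: `v = t ε_b` with `e t = F` (plumbing). [folklore] -/
private theorem exists_eq_single_of_smul_eq (he : 0 < e) {v : Fin N →₀ ℕ}
    (hv : e • v = Finsupp.single b F) : ∃ t, v = Finsupp.single b t ∧ e * t = F := by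
  refine ⟨v b, ?_, ?_⟩
  · ext x
    by_cases hx : x = b
    · subst hx; rw [Finsupp.single_eq_same]
    · have := congrArg (fun w => w x) hv
      simp only [Finsupp.smul_apply, smul_eq_mul, Finsupp.single_apply, if_neg (Ne.symm hx)] at this
      rw [Finsupp.single_apply, if_neg (Ne.symm hx)]
      exact (Nat.mul_eq_zero.1 this).resolve_left he.ne'
  · have := congrArg (fun w => w b) hv
    simpa only [Finsupp.smul_apply, smul_eq_mul, Finsupp.single_eq_same] using this

/-- The point-initial form at the vertex is the whole polynomial (plumbing). [cite: CossartJannsenSaito2020, Def. 8.2 (2)–(4) (p. 118)] -/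
private theorem pointInitial_powPair (hab : a ≠ b) (he : 0 < e) {v : Fin N →₀ ℕ}
    (hv : e • v = Finsupp.single b F) : pointInitial {a} e v (powPair k a b e F) = powPair k a b e F := by
  classical
  rw [pointInitial, Finset.filter_true_of_mem, ← (powPair k a b e F).as_sum]
  intro d hd
  rw [support_powPair hab he.ne', Finset.mem_insert, Finset.mem_singleton] at hd
  rcases hd with rfl | rfl
  · refine ⟨by rw [blockDeg_singleton, Finsupp.single_eq_same], ?_⟩
    rw [blockDeg_singleton, Finsupp.single_eq_same, Nat.sub_self, zero_smul, coPart_single_a]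
  · refine ⟨by rw [blockDeg_single_b hab]; exact he.le, ?_⟩
    rw [blockDeg_single_b hab, Nat.sub_zero, hv, coPart_single_b hab]

/-! ## §2 `δ`-preparedness: the vertex `(F/e) ε_b` is not solvable -/

/-- **Non-integral vertex**: if `e ∤ F` then `X_a^e + X_b^F` is `δ`-prepared with respect to `X_a` for free.
(derived here) [cite: CossartJannsenSaito2020, Thm. 8.16 / Thm. 8.22 (a) (p. 124) (solvable vertices are lattice points)] -/
theorem isDeltaPrepared_powPair_of_not_dvd (hab : a ≠ b) (he : 0 < e) (hndvd : ¬ e ∣ F) :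
    IsDeltaPrepared {a} e (powPair k a b e F) := by
  intro v _ hdeg
  exfalso
  rw [hironakaDelta_powPair hab he, WithTop.coe_eq_coe] at hdeg
  have he' : (e : ℚ) ≠ 0 := by exact_mod_cast he.ne'
  rw [eq_div_iff he'] at hdeg
  have h : v.degree * e = F := by exact_mod_cast hdeg
  exact hndvd (Dvd.intro_left _ h)

/-- `killVar` fixes constants (plumbing). [folklore] -/
private theorem killVar_C' {σ : Type*} [DecidableEq σ] (x : σ) (r : k) :
    killVar x (C r : MvPolynomial σ k) = C r := by
  simp [killVar]

/-- `c X_x^t ≠ 0` for `c ≠ 0` (plumbing). [folklore] -/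
private theorem C_mul_X_pow_ne_zero {σ : Type*} {c : k} (hc : c ≠ 0) (x : σ) (t : ℕ) :
    (C c * X x ^ t : MvPolynomial σ k) ≠ 0 :=
  mul_ne_zero (fun h => hc (C_eq_zero.1 h)) (pow_ne_zero _ (X_ne_zero x))

/-- Frobenius descent on the domain `k[X]`: `x^{p^m} = y^{p^m} ⟹ x = y` (plumbing). [folklore] -/
private theorem eq_of_pow_char_pow_eq {σ : Type*} (p m : ℕ) [hp : Fact p.Prime] [CharP k p]
    {x y : MvPolynomial σ k} (h : x ^ p ^ m = y ^ p ^ m) : x = y := by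
  haveI : ExpChar (MvPolynomial σ k) p := ExpChar.prime hp.out
  have h0 : (x - y) ^ p ^ m = 0 := by rw [sub_pow_expChar_pow, h, sub_self]
  exact sub_eq_zero.1 ((pow_eq_zero_iff (pow_pos hp.out.pos m).ne').1 h0)

/-- **No Tschirnhaus solution for an invertible exponent**: if `(e : k) ≠ 0` and `2 ≤ e` then
`X_a^e + X_b^F ≠ (X_a + c X_b^t)^e` for every constant `c` and every `t` — killing `X_a` forces `c ≠ 0`, and then
`∂/∂X_a`, cancelling `e` and killing `X_a` again gives `0 = (c X_b^t)^{e-1}`. (derived here)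
[cite: CossartJannsenSaito2020, Def. 8.13 (pp. 120–121) (solvability of a vertex)] -/
theorem powPair_ne_add_pow (hab : a ≠ b) (he : 2 ≤ e) (hek : (e : k) ≠ 0) (c : k) (t : ℕ) :
    powPair k a b e F ≠ (X a + C c * X b ^ t) ^ e := by
  classical
  have he0 : 0 < e := by omega
  intro hc
  -- (1) `c ≠ 0`: kill `X_a`
  have h1 := congrArg (killVar a) hc
  simp only [powPair, map_add, map_pow, map_mul, killVar_X, killVar_C', if_true, hab.symm, if_false,
    zero_pow he0.ne', zero_add] at h1
  -- h1 : X b ^ F = (C c * X b ^ t) ^ e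
  have hca : c ≠ 0 := by
    intro h0
    rw [h0, map_zero, zero_mul, zero_pow he0.ne'] at h1
    exact pow_ne_zero _ (X_ne_zero b) h1
  -- (2) differentiate with respect to `X_a` and cancel `e`
  have h2 := congrArg (pderiv a) hc
  simp only [powPair, map_add, Derivation.leibniz_pow, Derivation.leibniz, pderiv_X_self,
    pderiv_X_of_ne hab.symm, pderiv_C, smul_eq_mul, nsmul_eq_mul, mul_zero, add_zero, mul_one] at h2
  -- h2 : ↑e * X a ^ (e - 1) = ↑e * (X a + C c * X b ^ t) ^ (e - 1)
  have hne : (e : MvPolynomial (Fin N) k) ≠ 0 := by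
    rw [← map_natCast C e]
    exact fun h => hek (C_eq_zero.1 h)
  have h3 := mul_left_cancel₀ hne h2
  -- (3) kill `X_a` again
  have h4 := congrArg (killVar a) h3
  simp only [map_pow, map_add, map_mul, killVar_X, killVar_C', if_true, hab.symm, if_false,
    zero_pow (Nat.sub_ne_zero_of_lt (by omega : 1 < e)), zero_add] at h4
  -- h4 : 0 = (C c * X b ^ t) ^ (e - 1)
  exact pow_ne_zero _ (C_mul_X_pow_ne_zero hca b t) h4.symm

/-- A solution of the vertex, written out: `X_a^e + X_b^F = (X_a + c_a X_b^t)^e` (plumbing).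
[cite: CossartJannsenSaito2020, Def. 8.13 (pp. 120–121)] -/
private theorem eq_add_pow_of_isSolvableAt (hab : a ≠ b) (he : 0 < e) (heF : e < F) {t : ℕ}
    (hsv : e • (Finsupp.single b t : Fin N →₀ ℕ) = Finsupp.single b F)
    (hsol : IsSolvableAt {a} e (powPair k a b e F) (Finsupp.single b t)) :
    ∃ c : k, powPair k a b e F = (X a + C c * X b ^ t) ^ e := by
  classical
  obtain ⟨c, hc⟩ := hsol
  rw [zeroInitial_eq_homogeneousComponent (hFS_powPair heF), homogeneousComponent_powPair heF,
    pointInitial_powPair hab he hsv, map_pow, aeval_X] at hc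
  simp only [Finset.mem_singleton, if_true] at hc
  rw [← X_pow_eq_monomial] at hc
  exact ⟨c a, hc⟩

/-- **Invertible exponent**: if `(e : k) ≠ 0` (and `2 ≤ e < F`) then `X_a^e + X_b^F` is `δ`-prepared with respect
to `X_a`. (derived here) [cite: CossartJannsenSaito2020, Def. 8.13 (pp. 120–121), Def. 8.15 (p. 121)] -/
theorem isDeltaPrepared_powPair_of_natCast_ne_zero (hab : a ≠ b) (he : 2 ≤ e) (heF : e < F)
    (hek : (e : k) ≠ 0) : IsDeltaPrepared {a} e (powPair k a b e F) := by
  classical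
  have he0 : 0 < e := by omega
  intro v hv _ hsol
  have hsv := smul_eq_single_of_isVertex_powPair hab he0 hv
  obtain ⟨t, rfl, het⟩ := exists_eq_single_of_smul_eq he0 hsv
  obtain ⟨c, hc⟩ := eq_add_pow_of_isSolvableAt hab he0 heF hsv hsol
  exact powPair_ne_add_pow hab he hek c t hc

/-- **Exponent not a power of the characteristic**: in characteristic `p`, for `e = p^m e'` with `p ∤ e'`, `e' ≥ 2`
and `e < F`, `X_a^e + X_b^F` is `δ`-prepared with respect to `X_a`: a solution `X_a^e + X_b^F = (X_a + cX_b^t)^e`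
is `(X_a^{e'} + X_b^{e't})^{p^m} = ((X_a + cX_b^t)^{e'})^{p^m}` (freshman's dream), Frobenius is injective on
`k[X]`, and `e'` is invertible (`powPair_ne_add_pow`). (derived here)
[cite: CossartJannsenSaito2020, Def. 8.13 (pp. 120–121), Def. 8.15 (p. 121)] -/
theorem isDeltaPrepared_powPair_charP (p : ℕ) [hp : Fact p.Prime] [CharP k p] (hab : a ≠ b) {m e' : ℕ}
    (he' : 2 ≤ e') (hpe' : ¬ p ∣ e') (heF : p ^ m * e' < F) :
    IsDeltaPrepared {a} (p ^ m * e') (powPair k a b (p ^ m * e') F) := by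
  classical
  haveI : ExpChar (MvPolynomial (Fin N) k) p := ExpChar.prime hp.out
  have hq : 0 < p ^ m := pow_pos hp.out.pos m
  have he0 : 0 < p ^ m * e' := Nat.mul_pos hq (by omega)
  have he'k : (e' : k) ≠ 0 := fun h => hpe' ((CharP.cast_eq_zero_iff k p e').1 h)
  intro v hv _ hsol
  have hsv := smul_eq_single_of_isVertex_powPair hab he0 hv
  obtain ⟨t, rfl, het⟩ := exists_eq_single_of_smul_eq he0 hsv
  obtain ⟨c, hc⟩ := eq_add_pow_of_isSolvableAt hab he0 heF hsv hsol
  -- freshman's dream on both sides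
  have hL : powPair k a b (p ^ m * e') F = (powPair k a b e' (e' * t)) ^ p ^ m := by
    rw [powPair, powPair, add_pow_expChar_pow, ← pow_mul, ← pow_mul, Nat.mul_comm e' (p ^ m), ← het,
      Nat.mul_assoc, Nat.mul_comm (e' * t) (p ^ m)]
  have hR : (X a + C c * X b ^ t : MvPolynomial (Fin N) k) ^ (p ^ m * e') =
      ((X a + C c * X b ^ t) ^ e') ^ p ^ m := by
    rw [← pow_mul, Nat.mul_comm e' (p ^ m)]
  rw [hL, hR] at hc
  -- Frobenius is injective on the domain `k[X]`
  exact powPair_ne_add_pow hab he' he'k c t (eq_of_pow_char_pow_eq p m hc)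

/-! ## §3 Maximality -/

/-- **`(e, F) ∈ W(X_a^e + X_b^F)`**: the coordinate centre `(X_a^e, X_b^F)`, weights `(1/e, 1/F)`, every field.
(derived here: `WeightedCentreBlockMerge`) [cite: AbramovichTemkinWlodarczyk2024, Lemma 5.2.6 (p. 1576), §5.1 (p. 1575)] -/
theorem powPair_inv_mem (hab : a ≠ b) (he : 0 < e) (hF : 0 < F) (heF : e ≤ F) :
    [(e : ℚ), (F : ℚ)] ∈ admissibleInvariants (powPair k a b e F) := by
  classical
  have hdisj : ∀ x, singleWeights a e x = 0 ∨ singleWeights b F x = 0 := by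
    intro x
    by_cases hx : x = a
    · right; rw [singleWeights, if_neg (hx ▸ hab)]
    · left; rw [singleWeights, if_neg hx]
  have h := merge_mem_admissibleInvariants_add (isCentreFor_X_pow (k := k) a he)
    (isCentreFor_X_pow (k := k) b hF) (by simp) (by simp) hdisj
  rw [exps_singleWeights a he, exps_singleWeights b hF] at h
  have hsort : ([(e : ℚ)] ++ [(F : ℚ)]).insertionSort (· ≤ ·) = [(e : ℚ), (F : ℚ)] := by
    have heF' : (e : ℚ) ≤ F := by exact_mod_cast heF
    simp [List.insertionSort, heF']
  rw [hsort] at h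
  exact h

/-- Every non-zero weight contributes its inverse to `exps` (plumbing). [folklore] -/
private theorem inv_mem_exps_of_ne_zero₉ {γ : Fin N → ℚ} {x : Fin N} (hx : γ x ≠ 0) : (γ x)⁻¹ ∈ exps γ := by
  classical
  unfold exps
  rw [List.mem_insertionSort, List.mem_map]
  exact ⟨x, Finset.mem_toList.2 (Finset.mem_filter.2 ⟨Finset.mem_univ _, hx⟩), rfl⟩

/-- The head of a sorted list is its minimum (plumbing). [folklore] -/
private theorem le_of_mem_of_pairwise₉ {c x : ℚ} {es : List ℚ} (hs : (c :: es).Pairwise (· ≤ ·))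
    (hx : x ∈ c :: es) : c ≤ x := by
  rcases List.mem_cons.1 hx with rfl | hx
  · exact le_rfl
  · exact (List.pairwise_cons.1 hs).1 x hx

/-- **First face and vertex: nothing in `W(X_a^e + X_b^F)` is above `(e, F)`** (`2 ≤ e < F`, `a ≠ b`, any number of
spectators, all polynomial coordinate changes) as soon as `f` is `δ`-prepared with respect to `X_a`: the order gives
`b₁ ≤ e`, and `δ`-preparedness at the vertex `F/e · ε_b` gives a second entry `≤ e·δ = F`. (derived here, from the
vertex theorems of `WeightedCentreVertexPreparation`) [cite: AbramovichTemkinWlodarczyk2024, Thm. 5.3.1 (2) (p. 1578)]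
[cite: CossartJannsenSaito2020, Thm. 8.16 (p. 121)] -/
theorem not_lt_of_mem_admissibleInvariants_powPair_of_isDeltaPrepared (hab : a ≠ b) (he : 2 ≤ e) (heF : e < F)
    (hprep : IsDeltaPrepared {a} e (powPair k a b e F)) {c : List ℚ}
    (hc : c ∈ admissibleInvariants (powPair k a b e F)) : ¬ ATW.TruncLex.lt [(e : ℚ), (F : ℚ)] c := by
  classical
  have he0 : 0 < e := by omega
  have heq : (0 : ℚ) < e := by exact_mod_cast he0
  have heF' : (e : ℚ) < F := by exact_mod_cast heF
  have heδ : (e : ℚ) * ((F : ℚ) / (e : ℚ)) = F := by field_simp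
  set f := powPair k a b e F with hf
  have hord : monomialOrd (fun _ => 1) f = e := monomialOrd_powPair hab he0 heF.le
  have hin : homogeneousComponent e f = X a ^ e := homogeneousComponent_powPair heF
  have hτ : ({a} : Finset (Fin N)).card = hironakaTau k {homogeneousComponent e f} := by
    rw [hin, hironakaTau_X_pow a he0.ne', Finset.card_singleton]
  have hFS := hFS_powPair (k := k) (a := a) (b := b) heF
  have hδ : hironakaDelta {a} e f = ((((F : ℚ) / (e : ℚ)) : ℚ) : WithTop ℚ) :=
    hironakaDelta_powPair hab he0
  obtain ⟨Ψ, γ, h, rfl⟩ := hc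
  have hsorted := exps_sorted γ
  have hγpos : ∀ x, γ x ≠ 0 → 0 < γ x := fun x hx => lt_of_le_of_ne (h.2.1 x) (Ne.symm hx)
  by_cases hle : ∀ x, γ x ≤ (e : ℚ)⁻¹
  · -- `[e]` is a prefix of `exps γ`, and at least two entries are `≤ F`
    obtain ⟨es, hes⟩ : ∃ es, exps γ = (e : ℚ) :: es := by
      obtain ⟨t, ht⟩ := replicate_prefix_of_forall_le hord h hle
      rw [← hτ, Finset.card_singleton, List.replicate_one] at ht
      exact ⟨t, ht.symm⟩
    have hcount := succ_card_le_countP_exps_of_isDeltaPrepared hord hτ hFS hprep hδ h hle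
    rw [Finset.card_singleton, heδ, hes, List.countP_cons_of_pos (by simpa using heF'.le)] at hcount
    rw [hes] at hsorted
    obtain ⟨e₂, es', rfl⟩ : ∃ e₂ es', es = e₂ :: es' := by
      cases es with
      | nil => simp at hcount
      | cons e₂ es' => exact ⟨e₂, es', rfl⟩
    have hs₂ : (e₂ :: es').Pairwise (· ≤ ·) := (List.pairwise_cons.1 hsorted).2
    have he₂ : e₂ ≤ F := by
      have hpos : 0 < (e₂ :: es').countP fun x => decide (x ≤ (F : ℚ)) := by omega
      obtain ⟨x, hx, hxF⟩ := List.countP_pos_iff.1 hpos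
      exact (le_of_mem_of_pairwise₉ hs₂ hx).trans (by simpa using hxF)
    rw [hes, ATW.TruncLex.cons_lt_cons, ATW.TruncLex.cons_lt_cons]
    rintro (h1 | ⟨-, h2 | ⟨-, h3⟩⟩)
    · exact lt_irrefl _ h1
    · exact not_lt.2 he₂ h2
    · exact ATW.TruncLex.not_nil_lt _ h3
  · -- some weight exceeds `1/e`: the head of `exps γ` is `< e`
    push Not at hle
    obtain ⟨x, hx⟩ := hle
    have hγx : γ x ≠ 0 := (lt_trans (inv_pos.2 heq) hx).ne'
    have hlt : (γ x)⁻¹ < e := inv_lt_of_inv_lt₀ heq hx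
    have hmem := inv_mem_exps_of_ne_zero₉ hγx
    obtain ⟨c₁, cs, hcs⟩ : ∃ c₁ cs, exps γ = c₁ :: cs := by
      cases hq : exps γ with
      | nil => rw [hq] at hmem; simp at hmem
      | cons c₁ cs => exact ⟨c₁, cs, rfl⟩
    rw [hcs] at hmem hsorted ⊢
    have hc₁ : c₁ < e := (le_of_mem_of_pairwise₉ hsorted hmem).trans_lt hlt
    rw [ATW.TruncLex.cons_lt_cons]
    rintro (h1 | ⟨h2, -⟩)
    · exact lt_asymm hc₁ h1
    · exact hc₁.ne' h2

/-- **`max W(X_a^e + X_b^F) = (e, F)` from `δ`-preparedness** (`a ≠ b`, `2 ≤ e < F`, every field): the engine of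
this file. (derived here) [cite: AbramovichTemkinWlodarczyk2024, Thm. 5.3.1 (2)–(3) (p. 1578)]
[cite: CossartJannsenSaito2020, Thm. 8.16 (p. 121)] -/
theorem isMaxInv_powPair_of_isDeltaPrepared (hab : a ≠ b) (he : 2 ≤ e) (heF : e < F)
    (hprep : IsDeltaPrepared {a} e (powPair k a b e F)) :
    IsMaxInv (admissibleInvariants (powPair k a b e F)) [(e : ℚ), (F : ℚ)] :=
  ⟨powPair_inv_mem hab (by omega) (by omega) heF.le,
    fun _ hc => not_lt_of_mem_admissibleInvariants_powPair_of_isDeltaPrepared hab he heF hprep hc⟩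

/-- Nothing in `W(X_a^e + X_b^F)` is above `(e, F)` provided `(e : k) ≠ 0` or `e ∤ F`. (derived here)
[cite: AbramovichTemkinWlodarczyk2024, Thm. 5.3.1 (2) (p. 1578)] [cite: CossartJannsenSaito2020, Thm. 8.16 (p. 121)] -/
theorem not_lt_of_mem_admissibleInvariants_powPair (hab : a ≠ b) (he : 2 ≤ e) (heF : e < F)
    (hsolv : (e : k) ≠ 0 ∨ ¬ e ∣ F) {c : List ℚ} (hc : c ∈ admissibleInvariants (powPair k a b e F)) :
    ¬ ATW.TruncLex.lt [(e : ℚ), (F : ℚ)] c := by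
  refine not_lt_of_mem_admissibleInvariants_powPair_of_isDeltaPrepared hab he heF ?_ hc
  rcases hsolv with hek | hndvd
  · exact isDeltaPrepared_powPair_of_natCast_ne_zero hab he heF hek
  · exact isDeltaPrepared_powPair_of_not_dvd hab (by omega) hndvd

/-- **`max W(X_a^e + X_b^F) = (e, F)`** for `a ≠ b`, `2 ≤ e < F`, in every field in which `e` is invertible or
whenever `e ∤ F`: the coordinate centre `(X_a^e, X_b^F)` realises the invariant, maximised over ALL admissible
centres after ALL polynomial coordinate changes, spectator variables allowed. (derived here)
[cite: AbramovichTemkinWlodarczyk2024, Thm. 5.3.1 (2)–(3) (p. 1578)] [cite: CossartJannsenSaito2020, Thm. 8.16 (p. 121)] -/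
theorem isMaxInv_powPair (hab : a ≠ b) (he : 2 ≤ e) (heF : e < F) (hsolv : (e : k) ≠ 0 ∨ ¬ e ∣ F) :
    IsMaxInv (admissibleInvariants (powPair k a b e F)) [(e : ℚ), (F : ℚ)] :=
  ⟨powPair_inv_mem hab (by omega) (by omega) heF.le,
    fun _ hc => not_lt_of_mem_admissibleInvariants_powPair hab he heF hsolv hc⟩

/-- **Characteristic zero**: `max W(X_a^e + X_b^F) = (e, F)` for all `2 ≤ e < F`. (derived here)
[cite: AbramovichTemkinWlodarczyk2024, Thm. 5.3.1 (2)–(3) (p. 1578)] -/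
theorem isMaxInv_powPair_charZero [CharZero k] (hab : a ≠ b) (he : 2 ≤ e) (heF : e < F) :
    IsMaxInv (admissibleInvariants (powPair k a b e F)) [(e : ℚ), (F : ℚ)] :=
  isMaxInv_powPair hab he heF (Or.inl (by exact_mod_cast (show e ≠ 0 by omega)))

/-- **Non-divisible exponents, every characteristic**: `max W(X_a^e + X_b^F) = (e, F)` for `2 ≤ e < F`, `e ∤ F`.
(derived here) [cite: AbramovichTemkinWlodarczyk2024, Thm. 5.3.1 (2)–(3) (p. 1578)] -/
theorem isMaxInv_powPair_of_not_dvd (hab : a ≠ b) (he : 2 ≤ e) (heF : e < F) (hndvd : ¬ e ∣ F) :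
    IsMaxInv (admissibleInvariants (powPair k a b e F)) [(e : ℚ), (F : ℚ)] :=
  isMaxInv_powPair hab he heF (Or.inr hndvd)

/-- **Characteristic `p`, exponent not an absorbing `p`-power**: `max W(X_a^e + X_b^F) = (e, F)` for `a ≠ b`,
`2 ≤ e < F`, unless `e` is a power of `p` dividing `F`. (derived here)
[cite: AbramovichTemkinWlodarczyk2024, Thm. 5.3.1 (2)–(3) (p. 1578)] [cite: CossartJannsenSaito2020, Thm. 8.16 (p. 121)] -/
theorem isMaxInv_powPair_charP (p : ℕ) [hp : Fact p.Prime] [CharP k p] (hab : a ≠ b) (he : 2 ≤ e) (heF : e < F)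
    (h : ∀ n, e = p ^ n → ¬ e ∣ F) : IsMaxInv (admissibleInvariants (powPair k a b e F)) [(e : ℚ), (F : ℚ)] := by
  obtain ⟨m, e', hpe', hee'⟩ := Nat.exists_eq_pow_mul_and_not_dvd (by omega : e ≠ 0) p hp.out.ne_one
  by_cases he'1 : e' = 1
  · -- `e = p ^ m` is a `p`-power, hence does not divide `F`
    rw [he'1, mul_one] at hee'
    exact isMaxInv_powPair_of_not_dvd hab he heF (h m hee')
  · have he'0 : e' ≠ 0 := by rintro rfl; rw [mul_zero] at hee'; omega
    have he'2 : 2 ≤ e' := by omega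
    refine isMaxInv_powPair_of_isDeltaPrepared hab he heF ?_
    rw [hee'] at heF ⊢
    exact isDeltaPrepared_powPair_charP p hab he'2 hpe' heF

/-- **Characteristic `p`, absorbing `p`-power**: `max W(X_a^{p^n} + X_b^{p^n t}) = (p^n)` for `a ≠ b`, `t ≥ 1`
(including `t = 1`): the far power is absorbed by `X_a ↦ X_a + X_b^t`. (derived here, from
`admissibleInvariants_pureHandle_absorb` and `isMaxInv_X_pow`) [cite: AbramovichTemkinWlodarczyk2024, Thm. 5.3.1 (2)–(3) (p. 1578)] -/
theorem isMaxInv_powPair_absorb (p n : ℕ) [hp : Fact p.Prime] [CharP k p] (hab : a ≠ b) {t : ℕ} (ht : 0 < t) :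
    IsMaxInv (admissibleInvariants (powPair k a b (p ^ n) (p ^ n * t))) [((p ^ n : ℕ) : ℚ)] := by
  have h := admissibleInvariants_pureHandle_absorb (k := k) p n a [(b, t)] [] []
    (by intro d hd; rw [List.mem_singleton] at hd; rw [hd]; exact hab.symm)
    (by intro d hd; rw [List.mem_singleton] at hd; rw [hd]; exact ht) (by simp) (by simp)
  have h1 : pureHandle (k := k) ((a, p ^ n) :: (([(b, t)] : List (Fin N × ℕ)).map
      (fun d => (d.1, p ^ n * d.2)) ++ [])) [] = powPair k a b (p ^ n) (p ^ n * t) := by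
    simp [pureHandle, powPair]
  have h2 : pureHandle (k := k) [(a, p ^ n)] [] = X a ^ p ^ n := by simp [pureHandle]
  rw [h1, h2] at h
  rw [h]
  exact isMaxInv_X_pow a (pow_pos hp.out.pos n)

/-- **Characteristic `p`, absorbing `p`-power (divisibility form)**: `max W(X_a^{p^n} + X_b^F) = (p^n)` whenever
`p^n ∣ F`, `F ≥ 1`. (derived here) [cite: AbramovichTemkinWlodarczyk2024, Thm. 5.3.1 (2)–(3) (p. 1578)] -/
theorem isMaxInv_powPair_charP_dvd (p n : ℕ) [Fact p.Prime] [CharP k p] (hab : a ≠ b) (hF : 0 < F)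
    (hdvd : p ^ n ∣ F) : IsMaxInv (admissibleInvariants (powPair k a b (p ^ n) F)) [((p ^ n : ℕ) : ℚ)] := by
  obtain ⟨t, rfl⟩ := hdvd
  have ht : 0 < t := Nat.pos_of_ne_zero (by rintro rfl; simp at hF)
  exact isMaxInv_powPair_absorb p n hab ht

/-! ## §4 Equal exponents: `τ(X_a^e + X_b^e) = 2` and `max W(X_a^e + X_b^e) = (e, e)` -/

/-- In `k[Y, T]` (`Y_i = some i`, `T = none`): `(Y_a + αT)^e + (Y_b + βT)^e = Y_a^e + Y_b^e` with `e ≥ 2`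
invertible forces `α = 0` — kill `Y_b`, `∂/∂Y_a`, cancel `e`, kill `Y_a`: `(αT)^{e-1} = 0`. (plumbing) [folklore] -/
private theorem eq_zero_of_translate_powPair (hab : a ≠ b) (he : 2 ≤ e) (hek : (e : k) ≠ 0) {α β : k}
    (h : ((X (some a) + C α * X none) ^ e + (X (some b) + C β * X none) ^ e :
        MvPolynomial (Option (Fin N)) k) = X (some a) ^ e + X (some b) ^ e) : α = 0 := by
  classical
  have he0 : 0 < e := by omega
  have hsab : (some a : Option (Fin N)) ≠ some b := fun h' => hab (Option.some_injective _ h')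
  have hna : (none : Option (Fin N)) ≠ some a := (Option.some_ne_none a).symm
  have hnb : (none : Option (Fin N)) ≠ some b := (Option.some_ne_none b).symm
  -- kill `Y_b`
  have h1 := congrArg (killVar (some b)) h
  simp only [map_add, map_pow, map_mul, killVar_X, killVar_C', hsab, hnb, if_false, if_true, zero_add,
    zero_pow he0.ne', add_zero] at h1
  -- h1 : (X (some a) + C α * X none) ^ e + (C β * X none) ^ e = X (some a) ^ e
  -- `∂/∂Y_a` and cancel `e`
  have h2 := congrArg (pderiv (some a)) h1
  simp only [map_add, Derivation.leibniz_pow, Derivation.leibniz, pderiv_X_self, pderiv_X_of_ne hna,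
    pderiv_C, smul_eq_mul, nsmul_eq_mul, mul_zero, add_zero, mul_one, smul_zero] at h2
  -- h2 : ↑e * (X (some a) + C α * X none) ^ (e - 1) = ↑e * X (some a) ^ (e - 1)
  have hne : (e : MvPolynomial (Option (Fin N)) k) ≠ 0 := by
    rw [← map_natCast C e]
    exact fun h => hek (C_eq_zero.1 h)
  have h3 := mul_left_cancel₀ hne h2
  -- kill `Y_a`
  have h4 := congrArg (killVar (some a)) h3
  simp only [map_pow, map_add, map_mul, killVar_X, killVar_C', if_true, hna, if_false, zero_add,
    zero_pow (Nat.sub_ne_zero_of_lt (by omega : 1 < e))] at h4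
  -- h4 : (C α * X none) ^ (e - 1) = 0
  by_contra hα
  exact pow_ne_zero _ (mul_ne_zero (fun h => hα (C_eq_zero.1 h)) (X_ne_zero none)) h4

/-- The variables of `X_a^e + X_b^F` (plumbing). [folklore] -/
private theorem vars_powPair_subset : (powPair k a b e F).vars ⊆ {a, b} := by
  classical
  intro x hx
  rw [powPair] at hx
  rcases Finset.mem_union.1 (vars_add_subset _ _ hx) with h | h
  · have h' := vars_pow _ _ h
    rw [vars_X, Finset.mem_singleton] at h'
    simp [h']
  · have h' := vars_pow _ _ h
    rw [vars_X, Finset.mem_singleton] at h'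
    simp [h']

/-- `τ(X_a^e + X_b^e) = 2` from the triviality of invariant translations (plumbing).
[cite: CossartJannsenSaito2020, Def. 1.26 / Lemma 1.27 (τ = codimension of the directrix)] -/
private theorem hironakaTau_powPair_self_of (hab : a ≠ b)
    (H : ∀ {a' b' : Fin N}, a' ≠ b' → ∀ {α β : k},
      ((X (some a') + C α * X none) ^ e + (X (some b') + C β * X none) ^ e :
        MvPolynomial (Option (Fin N)) k) = X (some a') ^ e + X (some b') ^ e → α = 0) :
    hironakaTau k {powPair k a b e e} = 2 := by
  classical
  refine (hironakaTau_singleton_eq_card (s := ({a, b} : Finset (Fin N))) vars_powPair_subset ?_).trans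
    (Finset.card_pair hab)
  intro w hw x hx
  have h := (mem_invarianceSpace_iff k).1 hw _ (Set.mem_singleton _)
  simp only [powPair, map_add, map_pow, rename_X, translate_X_some] at h
  -- h : (X (some a) + C (w a) * X none) ^ e + (X (some b) + C (w b) * X none) ^ e = X (some a) ^ e + X (some b) ^ e
  rcases Finset.mem_insert.1 hx with rfl | hx
  · exact H hab h
  · rw [Finset.mem_singleton.1 hx]
    rw [add_comm, add_comm (X (some a) ^ e)] at h
    exact H hab.symm h

/-- **`τ(X_a^e + X_b^e) = 2`** (`a ≠ b`, `e ≥ 2` invertible in `k`; spectators allowed): no non-zero translation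
leaves the form invariant. (derived here) [cite: CossartJannsenSaito2020, Def. 1.26 / Lemma 1.27] -/
theorem hironakaTau_powPair_self (hab : a ≠ b) (he : 2 ≤ e) (hek : (e : k) ≠ 0) :
    hironakaTau k {powPair k a b e e} = 2 :=
  hironakaTau_powPair_self_of hab fun hab' _ _ h => eq_zero_of_translate_powPair hab' he hek h

/-- **`τ(X_a^e + X_b^e) = 2` in characteristic `p` for `e` not a power of `p`** (`e = p^m e'`, `p ∤ e'`,
`e' ≥ 2`): Frobenius descent to the invertible exponent `e'`. (derived here)
[cite: CossartJannsenSaito2020, Def. 1.26 / Lemma 1.27] -/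
theorem hironakaTau_powPair_self_charP (p : ℕ) [hp : Fact p.Prime] [CharP k p] (hab : a ≠ b) {m e' : ℕ}
    (he' : 2 ≤ e') (hpe' : ¬ p ∣ e') : hironakaTau k {powPair k a b (p ^ m * e') (p ^ m * e')} = 2 := by
  haveI : ExpChar (MvPolynomial (Option (Fin N)) k) p := ExpChar.prime hp.out
  have he'k : (e' : k) ≠ 0 := fun h => hpe' ((CharP.cast_eq_zero_iff k p e').1 h)
  refine hironakaTau_powPair_self_of hab fun {a' b'} hab' α β h => ?_
  have h' : ((X (some a') + C α * X none) ^ e' + (X (some b') + C β * X none) ^ e' :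
      MvPolynomial (Option (Fin N)) k) = X (some a') ^ e' + X (some b') ^ e' := by
    refine eq_of_pow_char_pow_eq p m ?_
    rw [add_pow_expChar_pow, add_pow_expChar_pow, ← pow_mul, ← pow_mul, ← pow_mul, ← pow_mul,
      Nat.mul_comm e' (p ^ m)]
    exact h
  exact eq_zero_of_translate_powPair hab' he' he'k h'

/-- **`max W(X_a^e + X_b^e) = (e, e)` whenever `τ = 2`** (`a ≠ b`, `e ≥ 1`): the initial form is the whole
(homogeneous) polynomial, so `τ = 2` pins the prefix `(e, e)` of every admissible invariant with small weights, and
the coordinate centre `(X_a^e, X_b^e)` attains it. (derived here, from `isMaxInv_replicate_of_mem`)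
[cite: AbramovichTemkinWlodarczyk2024, Thm. 5.3.1 (2)–(3) (p. 1578)] -/
theorem isMaxInv_powPair_self_of_hironakaTau (hab : a ≠ b) (he : 0 < e)
    (hτ : hironakaTau k {powPair k a b e e} = 2) :
    IsMaxInv (admissibleInvariants (powPair k a b e e)) [(e : ℚ), (e : ℚ)] := by
  have hord : monomialOrd (fun _ => 1) (powPair k a b e e) = e := monomialOrd_powPair hab he le_rfl
  have hin : homogeneousComponent e (powPair k a b e e) = powPair k a b e e := by
    rw [powPair, map_add, homogeneousComponent_of_mem (isHomogeneous_X_pow a e),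
      homogeneousComponent_of_mem (isHomogeneous_X_pow b e), if_pos rfl, if_pos rfl]
  have hmem : List.replicate (hironakaTau k {homogeneousComponent e (powPair k a b e e)}) (e : ℚ) ∈
      admissibleInvariants (powPair k a b e e) := by
    rw [hin, hτ]
    exact powPair_inv_mem hab he he le_rfl
  have h := isMaxInv_replicate_of_mem hord hmem
  rw [hin, hτ] at h
  exact h

/-- **`max W(X_a^e + X_b^e) = (e, e)`** for `a ≠ b` and `e ≥ 2` invertible in `k`. (derived here)
[cite: AbramovichTemkinWlodarczyk2024, Thm. 5.3.1 (2)–(3) (p. 1578)] -/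
theorem isMaxInv_powPair_self (hab : a ≠ b) (he : 2 ≤ e) (hek : (e : k) ≠ 0) :
    IsMaxInv (admissibleInvariants (powPair k a b e e)) [(e : ℚ), (e : ℚ)] :=
  isMaxInv_powPair_self_of_hironakaTau hab (by omega) (hironakaTau_powPair_self hab he hek)

/-- **Characteristic `p`, equal exponents**: `max W(X_a^e + X_b^e) = (e, e)` unless `e` is a power of `p`
(then `X_b^e` is absorbed: `isMaxInv_powPair_absorb` with `t = 1`). (derived here)
[cite: AbramovichTemkinWlodarczyk2024, Thm. 5.3.1 (2)–(3) (p. 1578)] -/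
theorem isMaxInv_powPair_self_charP (p : ℕ) [hp : Fact p.Prime] [CharP k p] (hab : a ≠ b) (he : 2 ≤ e)
    (h : ∀ n, e ≠ p ^ n) : IsMaxInv (admissibleInvariants (powPair k a b e e)) [(e : ℚ), (e : ℚ)] := by
  obtain ⟨m, e', hpe', hee'⟩ := Nat.exists_eq_pow_mul_and_not_dvd (by omega : e ≠ 0) p hp.out.ne_one
  have he'1 : e' ≠ 1 := by rintro rfl; exact h m (by rw [hee', mul_one])
  have he'0 : e' ≠ 0 := by rintro rfl; rw [mul_zero] at hee'; omega
  refine isMaxInv_powPair_self_of_hironakaTau hab (by omega) ?_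
  rw [hee']
  exact hironakaTau_powPair_self_charP p hab (by omega) hpe'

/-! ## §5 The laws -/

/-- **Characteristic zero**: `max W(X_a^e + X_b^F) = (e, F)` for all `a ≠ b`, `2 ≤ e ≤ F`. (derived here)
[cite: AbramovichTemkinWlodarczyk2024, Thm. 5.3.1 (2)–(3) (p. 1578)] -/
theorem isMaxInv_powPair_charZero_of_le [CharZero k] (hab : a ≠ b) (he : 2 ≤ e) (heF : e ≤ F) :
    IsMaxInv (admissibleInvariants (powPair k a b e F)) [(e : ℚ), (F : ℚ)] := by
  rcases heF.eq_or_lt with rfl | hlt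
  · exact isMaxInv_powPair_self hab he (by exact_mod_cast (show e ≠ 0 by omega))
  · exact isMaxInv_powPair_charZero hab he hlt

open Classical in
/-- **The two-summand law `CL_p`** (census engine 1, FE33 C136 (b)–(d)) as a theorem of the model: in characteristic
`p`, for `a ≠ b` and `2 ≤ e ≤ F`, `max W(X_a^e + X_b^F)` is `(e)` if `e` is a power of `p` dividing `F`, and `(e, F)`
otherwise. (derived here) [cite: AbramovichTemkinWlodarczyk2024, Thm. 5.3.1 (2)–(3) (p. 1578)]
[cite: CossartJannsenSaito2020, Thm. 8.16 (p. 121)] -/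
theorem isMaxInv_powPair_law (p : ℕ) [Fact p.Prime] [CharP k p] (hab : a ≠ b) (he : 2 ≤ e) (heF : e ≤ F) :
    IsMaxInv (admissibleInvariants (powPair k a b e F))
      (if (∃ n, e = p ^ n) ∧ e ∣ F then [(e : ℚ)] else [(e : ℚ), (F : ℚ)]) := by
  split_ifs with hcase
  · obtain ⟨⟨n, rfl⟩, hdvd⟩ := hcase
    exact isMaxInv_powPair_charP_dvd p n hab (by omega) hdvd
  · rcases heF.eq_or_lt with rfl | hlt
    · exact isMaxInv_powPair_self_charP p hab he fun n hn => hcase ⟨⟨n, hn⟩, hn ▸ dvd_rfl⟩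
    · exact isMaxInv_powPair_charP p hab he hlt fun n hn hdvd => hcase ⟨⟨n, hn⟩, hdvd⟩

/-! ## §6 Census-style instances -/

-- `max W(x² + y³) = (2, 3)` in every characteristic (the cusp; `2 ∤ 3`).
example (hab : a ≠ b) : IsMaxInv (admissibleInvariants (X a ^ 2 + X b ^ 3 : MvPolynomial (Fin N) k)) [2, 3] := by
  have h := isMaxInv_powPair_of_not_dvd (k := k) hab le_rfl (by norm_num : 2 < 3) (by norm_num)
  rw [powPair_eq] at h
  exact_mod_cast h

-- `max W(x³ + y⁶) = (3, 6)` over fields of characteristic `2` (`3` is invertible although `3 ∣ 6`).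
example [CharP k 2] (hab : a ≠ b) :
    IsMaxInv (admissibleInvariants (X a ^ 3 + X b ^ 6 : MvPolynomial (Fin N) k)) [3, 6] := by
  have h3 : ((3 : ℕ) : k) ≠ 0 := by
    have h2 : (2 : k) = 0 := by simpa using CharP.cast_eq_zero k 2
    have : ((3 : ℕ) : k) = 2 + 1 := by push_cast; norm_num
    rw [this, h2, zero_add]; exact one_ne_zero
  have h := isMaxInv_powPair (k := k) hab (by norm_num : 2 ≤ 3) (by norm_num : 3 < 6) (Or.inl h3)
  rw [powPair_eq] at h
  exact_mod_cast h

-- `max W(x⁶ + y¹²) = (6, 12)` over fields of characteristic `2` (`6 = 2·3` is not a power of `2`; the law keeps `12`).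
example [CharP k 2] (hab : a ≠ b) :
    IsMaxInv (admissibleInvariants (X a ^ 6 + X b ^ 12 : MvPolynomial (Fin N) k)) [6, 12] := by
  haveI : Fact (Nat.Prime 2) := ⟨Nat.prime_two⟩
  have h := isMaxInv_powPair_charP (k := k) 2 hab (by norm_num : 2 ≤ 6) (by norm_num : 6 < 12)
    (by
      intro n hn
      exfalso
      have h3 : 3 ∣ 2 ^ n := ⟨2, by omega⟩
      have := (Nat.Prime.dvd_of_dvd_pow Nat.prime_three h3)
      omega)
  rw [powPair_eq] at h
  exact_mod_cast h

-- `max W(x⁴ + y⁶) = (4, 6)` over fields of characteristic `2` (`4 = 2²` does not divide `6`).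
example [CharP k 2] (hab : a ≠ b) :
    IsMaxInv (admissibleInvariants (X a ^ 4 + X b ^ 6 : MvPolynomial (Fin N) k)) [4, 6] := by
  have h := isMaxInv_powPair_of_not_dvd (k := k) hab (by norm_num : 2 ≤ 4) (by norm_num : 4 < 6) (by norm_num)
  rw [powPair_eq] at h
  exact_mod_cast h

-- `max W(x² + y⁴) = (2)` over fields of characteristic `2` (`y⁴` is absorbed: `x² + y⁴ = (x + y²)²`).
example [CharP k 2] (hab : a ≠ b) :
    IsMaxInv (admissibleInvariants (X a ^ 2 + X b ^ 4 : MvPolynomial (Fin N) k)) [2] := by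
  haveI : Fact (Nat.Prime 2) := ⟨Nat.prime_two⟩
  have h := isMaxInv_powPair_absorb (k := k) 2 1 hab (t := 2) (by norm_num)
  rw [powPair_eq] at h
  exact_mod_cast h

-- `max W(x³ + y³) = (3, 3)` over fields of characteristic `2`; `max W(x² + y²) = (2, 2)` whenever `2 ≠ 0`.
example [CharP k 2] (hab : a ≠ b) :
    IsMaxInv (admissibleInvariants (X a ^ 3 + X b ^ 3 : MvPolynomial (Fin N) k)) [3, 3] := by
  have h3 : ((3 : ℕ) : k) ≠ 0 := by
    have h2 : (2 : k) = 0 := by simpa using CharP.cast_eq_zero k 2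
    have : ((3 : ℕ) : k) = 2 + 1 := by push_cast; norm_num
    rw [this, h2, zero_add]; exact one_ne_zero
  have h := isMaxInv_powPair_self (k := k) hab (by norm_num : 2 ≤ 3) h3
  rw [powPair_eq] at h
  exact_mod_cast h

example (h2 : (2 : k) ≠ 0) (hab : a ≠ b) :
    IsMaxInv (admissibleInvariants (X a ^ 2 + X b ^ 2 : MvPolynomial (Fin N) k)) [2, 2] := by
  have h := isMaxInv_powPair_self (k := k) hab (le_rfl : 2 ≤ 2) (by exact_mod_cast h2)
  rw [powPair_eq] at h
  exact_mod_cast h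

-- The law at `p = 2` for `x⁶ + y⁶` and `x⁴ + y⁴`: `(6, 6)` and `(4)`.
example [CharP k 2] (hab : a ≠ b) :
    IsMaxInv (admissibleInvariants (X a ^ 6 + X b ^ 6 : MvPolynomial (Fin N) k)) [6, 6] := by
  haveI : Fact (Nat.Prime 2) := ⟨Nat.prime_two⟩
  have h := isMaxInv_powPair_law (k := k) 2 hab (by norm_num : 2 ≤ 6) (le_rfl : 6 ≤ 6)
  have hne : ¬ ((∃ n, 6 = 2 ^ n) ∧ 6 ∣ 6) := by
    rintro ⟨⟨n, hn⟩, -⟩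
    have h3 : 3 ∣ 2 ^ n := ⟨2, by omega⟩
    have := Nat.Prime.dvd_of_dvd_pow Nat.prime_three h3
    omega
  rw [if_neg hne, powPair_eq] at h
  exact_mod_cast h

example [CharP k 2] (hab : a ≠ b) :
    IsMaxInv (admissibleInvariants (X a ^ 4 + X b ^ 4 : MvPolynomial (Fin N) k)) [4] := by
  haveI : Fact (Nat.Prime 2) := ⟨Nat.prime_two⟩
  have h := isMaxInv_powPair_law (k := k) 2 hab (by norm_num : 2 ≤ 4) (le_rfl : 4 ≤ 4)
  rw [if_pos ⟨⟨2, by norm_num⟩, dvd_rfl⟩, powPair_eq] at h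
  exact_mod_cast h

end Literature.AlgebraicGeometry.Resolution.WeightedBlowup

-- #harness_tags
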